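import Mathlib.Analysis.Calculus.Deriv.Shift
import Literature.Analysis.FluidPDE.MVWeakStrongUniqueness
import Literature.Analysis.FluidPDE.TorusHeatForcedIcc
import Literature.Analysis.FunctionSpaces.TorusCalculusProofs
import Literature.Analysis.FunctionSpaces.TorusSpaceTime
import HarnessLib

/-!
# Classical solutions of the complete Euler system on a general time set: restriction, time
# translation and gluing along an open overlap

Analysis/FluidPDE support file (everything proved) for the local theory of the complete
compressible Euler system on `𝕋³` (`CompressibleEuler.IsClassicalEulerSolution eos T ρ u ϑ`,
`MVWeakStrongUniqueness.lean`: jointly `C^∞` fields on `[0, T) × 𝕋³`, `ρ, ϑ > 0`, the three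
conservation laws pointwise with the one-sided time derivative within `[0, T)`), first layer of
the programme to discharge `Literature.Analysis.FluidPDE.CompressibleEulerLocalWellPosedness`
(Majda 1984, Ch. 2, Thms 2.1–2.2): the CONTINUATION half of that fact is proved by restarting the
local existence theorem at a time `t₀ < T` and gluing the restarted solution to the given one
along the open overlap `(t₀, T)` on which they agree (uniqueness). This file supplies the
bookkeeping, the torus twin of `ClassicalSolutionGlue.lean` (incompressible Navier–Stokes on `ℝ³`):

* `CompressibleEuler.IsClassicalEulerSolutionOn eos S ρ u ϑ` — the same eight clauses on an
  arbitrary time set `S ⊆ ℝ` (time derivative within `S`); `isClassicalEulerSolutionOn_Ico_iff`: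
  for `S = [0, T)` this is literally `IsClassicalEulerSolution eos T`;
* `IsClassicalEulerSolutionOn.comp_add_right` (time translation, the system is autonomous),
  `IsClassicalEulerSolutionOn.mono` (smaller time set of unique differentiability; needs the
  internal energy `e` smooth on `ρ, ϑ > 0` so that the energy density is differentiable in time),
  `IsClassicalEulerSolution.translate_Ico`, `IsClassicalEulerSolution.on_Ioo_of_translate`;
* `IsClassicalEulerSolutionOn.glue` — a solution on `[0, T)` and a solution on `(a, b)`,
  `0 ≤ a < T ≤ b`, agreeing on `(a, T)`, glue to a solution on `[0, b)`;
* `IsClassicalEulerSolution.extend_of_restart` — the packaged restart step used by the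
  continuation argument.

All statements are folklore bookkeeping (smoothness and derivatives are local; Mathlib
`contDiffOn_of_locally_contDiffOn`, `derivWithin_inter`, `derivWithin_of_mem_nhds`,
`derivWithin_comp_add_const`).

## References

* A. Majda, *Compressible Fluid Flow and Systems of Conservation Laws in Several Space
  Variables*, Appl. Math. Sci. 53, Springer 1984, Ch. 2, §2.1, Thm 2.2 and Cor. 2 (restart /
  maximal interval of classical existence). [`Majda1984`]
* C. M. Dafermos, *Hyperbolic Conservation Laws in Continuum Physics*, 2nd ed. (2005), Ch. V,
  §5.1, proof of Thm 5.1.1 ("we may repeat the above construction and extend `U` to a larger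
  time interval"). [`Dafermos2005`]
-/

noncomputable section

open Set Function Filter
open scoped ContDiff _root_.Topology

namespace Literature.Analysis.FluidPDE

namespace CompressibleEuler

open Literature.Analysis.FunctionSpaces

/-! ## Classical solutions on a general time set -/

/-- **Classical solution of the complete Euler system (1.1)–(1.3) on `S × 𝕋³`** for a time set
`S ⊆ ℝ` and the equation of state `eos`: the eight clauses of
`CompressibleEuler.IsClassicalEulerSolution` (jointly smooth `ρ, u, ϑ`, `ρ, ϑ > 0`, mass,
momentum and energy conservation pointwise) with `[0, T)` replaced by `S` throughout, the time
derivative being the one-sided `Torus.timeDerivWithin S` (torus twin of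
`Literature.Analysis.FluidPDE.IsClassicalNSSolutionOn S`). For `S = Ico 0 T` it is
`IsClassicalEulerSolution eos T` (`isClassicalEulerSolutionOn_Ico_iff`); it is introduced only to
state time translation and gluing, whose intermediate time sets are `(a, b)`. [folklore] -/
structure IsClassicalEulerSolutionOn (eos : EulerEOS) (S : Set ℝ) (ρ : ℝ → UnitAddTorus (Fin 3) → ℝ)
    (u : ℝ → UnitAddTorus (Fin 3) → EuclideanSpace ℝ (Fin 3))
    (ϑ : ℝ → UnitAddTorus (Fin 3) → ℝ) : Prop where
  smooth_density : FunctionSpaces.Torus.IsSmoothSpaceTimeOn S ρ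
  smooth_velocity : FunctionSpaces.Torus.IsSmoothSpaceTimeOn S u
  smooth_temperature : FunctionSpaces.Torus.IsSmoothSpaceTimeOn S ϑ
  density_pos : ∀ t ∈ S, ∀ x, 0 < ρ t x
  temperature_pos : ∀ t ∈ S, ∀ x, 0 < ϑ t x
  mass : ∀ t ∈ S, ∀ x,
    FunctionSpaces.Torus.timeDerivWithin S ρ t x +
      FunctionSpaces.Torus.divergence (fun y => ρ t y • u t y) x = 0
  momentum : ∀ t ∈ S, ∀ x,
    FunctionSpaces.Torus.timeDerivWithin S (fun s y => ρ s y • u s y) t x +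
      (∑ i, FunctionSpaces.Torus.partialDeriv i (fun y => (ρ t y * u t y i) • u t y) x) +
      FunctionSpaces.Torus.gradient (fun y => eos.p (ρ t y) (ϑ t y)) x = 0
  energy : ∀ t ∈ S, ∀ x,
    FunctionSpaces.Torus.timeDerivWithin S
        (fun s y => ρ s y * (‖u s y‖ ^ 2 / 2 + eos.e (ρ s y) (ϑ s y))) t x +
      FunctionSpaces.Torus.divergence (fun y =>
        (ρ t y * (‖u t y‖ ^ 2 / 2 + eos.e (ρ t y) (ϑ t y)) + eos.p (ρ t y) (ϑ t y)) • u t y) x = 0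

variable {eos : EulerEOS} {S S' : Set ℝ} {T : ℝ}
  {ρ : ℝ → UnitAddTorus (Fin 3) → ℝ} {u : ℝ → UnitAddTorus (Fin 3) → EuclideanSpace ℝ (Fin 3)}
  {ϑ : ℝ → UnitAddTorus (Fin 3) → ℝ}

/-- On `S = [0, T)` the general-time-set notion is literally `IsClassicalEulerSolution eos T`
(field by field). [folklore] -/
theorem isClassicalEulerSolutionOn_Ico_iff :
    IsClassicalEulerSolutionOn eos (Ico 0 T) ρ u ϑ ↔ IsClassicalEulerSolution eos T ρ u ϑ :=
  ⟨fun h => ⟨h.1, h.2, h.3, h.4, h.5, h.6, h.7, h.8⟩, fun h => ⟨h.1, h.2, h.3, h.4, h.5, h.6, h.7, h.8⟩⟩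

/-- The momentum density `ρu` of a classical solution is jointly smooth on `S × 𝕋³`. [folklore] -/
theorem IsClassicalEulerSolutionOn.smooth_momentumDensity (h : IsClassicalEulerSolutionOn eos S ρ u ϑ) :
    FunctionSpaces.Torus.IsSmoothSpaceTimeOn S (fun s y => ρ s y • u s y) :=
  h.smooth_density.smul h.smooth_velocity

/-- If the internal energy `e` is smooth on the open quadrant `ρ, ϑ > 0`, the energy density
`ρ(|u|²/2 + e(ρ, ϑ))` of a classical solution is jointly smooth on `S × 𝕋³` (chain rule through
`(t, y) ↦ (ρ, ϑ)(t, y) ∈ (0, ∞)²`). [folklore] -/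
theorem IsClassicalEulerSolutionOn.smooth_energyDensity (h : IsClassicalEulerSolutionOn eos S ρ u ϑ)
    (he : ContDiffOn ℝ ∞ (uncurry eos.e) (Ioi 0 ×ˢ Ioi 0)) :
    FunctionSpaces.Torus.IsSmoothSpaceTimeOn S
      (fun s y => ρ s y * (‖u s y‖ ^ 2 / 2 + eos.e (ρ s y) (ϑ s y))) := by
  have hpair : ContDiffOn ℝ ∞
      (fun z => (FunctionSpaces.Torus.stLift ρ z, FunctionSpaces.Torus.stLift ϑ z))
      (S ×ˢ (univ : Set (EuclideanSpace ℝ (Fin 3)))) :=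
    h.smooth_density.prodMk h.smooth_temperature
  have hmaps : MapsTo (fun z => (FunctionSpaces.Torus.stLift ρ z, FunctionSpaces.Torus.stLift ϑ z))
      (S ×ˢ (univ : Set (EuclideanSpace ℝ (Fin 3)))) (Ioi 0 ×ˢ Ioi 0) := by
    rintro ⟨t, y⟩ ht
    exact ⟨h.density_pos t ht.1 _, h.temperature_pos t ht.1 _⟩
  have hE : ContDiffOn ℝ ∞
      (fun z => eos.e (FunctionSpaces.Torus.stLift ρ z) (FunctionSpaces.Torus.stLift ϑ z))
      (S ×ˢ (univ : Set (EuclideanSpace ℝ (Fin 3)))) := he.comp hpair hmaps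
  have hkin : FunctionSpaces.Torus.IsSmoothSpaceTimeOn S (fun s y => ‖u s y‖ ^ 2 / 2) := by
    have h1 : FunctionSpaces.Torus.IsSmoothSpaceTimeOn S (fun s y => ‖u s y‖ ^ 2) := by
      change ContDiffOn ℝ ∞ (fun z => ‖FunctionSpaces.Torus.stLift u z‖ ^ 2) _
      exact h.smooth_velocity.norm_sq ℝ
    exact h1.div_const 2
  exact h.smooth_density.mul (hkin.add hE)

/-! ## Restriction of the time set -/

/-- On a smaller time set of unique differentiability the one-sided time derivative of a jointly
smooth torus field is unchanged (Mathlib `HasDerivWithinAt.mono`, `HasDerivWithinAt.derivWithin`;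
torus twin of `IsSmoothSpaceTimeOn.timeDerivWithin_eq_of_subset`). [folklore] -/
theorem timeDerivWithin_eq_of_subset {F : Type*} [NormedAddCommGroup F] [NormedSpace ℝ F]
    {w : ℝ → UnitAddTorus (Fin 3) → F} (h : FunctionSpaces.Torus.IsSmoothSpaceTimeOn S w)
    (hS' : S' ⊆ S) (hU : UniqueDiffOn ℝ S') {t : ℝ} (ht : t ∈ S') (x : UnitAddTorus (Fin 3)) :
    FunctionSpaces.Torus.timeDerivWithin S' w t x = FunctionSpaces.Torus.timeDerivWithin S w t x :=
  ((h.hasDerivWithinAt_slice (hS' ht) x).mono hS').derivWithin (hU t ht)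

/-- **Restriction of the time set.** A classical solution on `S` is a classical solution on any
`S' ⊆ S` of unique differentiability (`S'` open, or an interval `Ico a b`, …), provided the
internal energy `e` is smooth on `ρ, ϑ > 0` (so that all three conserved densities are
differentiable in time within `S`, and their one-sided time derivatives within `S'` and within
`S` agree). [folklore] -/
theorem IsClassicalEulerSolutionOn.mono (h : IsClassicalEulerSolutionOn eos S ρ u ϑ)
    (he : ContDiffOn ℝ ∞ (uncurry eos.e) (Ioi 0 ×ˢ Ioi 0)) (hS' : S' ⊆ S)
    (hU : UniqueDiffOn ℝ S') : IsClassicalEulerSolutionOn eos S' ρ u ϑ where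
  smooth_density := h.smooth_density.mono hS'
  smooth_velocity := h.smooth_velocity.mono hS'
  smooth_temperature := h.smooth_temperature.mono hS'
  density_pos t ht x := h.density_pos t (hS' ht) x
  temperature_pos t ht x := h.temperature_pos t (hS' ht) x
  mass t ht x := by
    rw [timeDerivWithin_eq_of_subset h.smooth_density hS' hU ht x]
    exact h.mass t (hS' ht) x
  momentum t ht x := by
    rw [timeDerivWithin_eq_of_subset h.smooth_momentumDensity hS' hU ht x]
    exact h.momentum t (hS' ht) x
  energy t ht x := by
    rw [timeDerivWithin_eq_of_subset (h.smooth_energyDensity he) hS' hU ht x]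
    exact h.energy t (hS' ht) x

/-! ## Time translation -/

/-- **Time translation of classical solutions.** The complete Euler system is autonomous: if
`(ρ, u, ϑ)` is a classical solution on the time set `S`, then `(ρ, u, ϑ)(· + a)` is a classical
solution on `(· + a)⁻¹' S` (the clauses are pointwise in `t`; the one-sided time derivative
translates by `Torus.timeDerivWithin_comp_add_const`). [folklore] -/
theorem IsClassicalEulerSolutionOn.comp_add_right (h : IsClassicalEulerSolutionOn eos S ρ u ϑ)
    (a : ℝ) :
    IsClassicalEulerSolutionOn eos ((· + a) ⁻¹' S) (fun t => ρ (t + a)) (fun t => u (t + a))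
      (fun t => ϑ (t + a)) where
  smooth_density := h.smooth_density.comp_add_const a
  smooth_velocity := h.smooth_velocity.comp_add_const a
  smooth_temperature := h.smooth_temperature.comp_add_const a
  density_pos t ht x := h.density_pos (t + a) ht x
  temperature_pos t ht x := h.temperature_pos (t + a) ht x
  mass t ht x := by
    rw [Torus.timeDerivWithin_comp_add_const]
    exact h.mass (t + a) ht x
  momentum t ht x := by
    have key := Torus.timeDerivWithin_comp_add_const S (fun s y => ρ s y • u s y) a t x
    rw [key]
    exact h.momentum (t + a) ht x
  energy t ht x := by
    have key := Torus.timeDerivWithin_comp_add_const S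
      (fun s y => ρ s y * (‖u s y‖ ^ 2 / 2 + eos.e (ρ s y) (ϑ s y))) a t x
    rw [key]
    exact h.energy (t + a) ht x

/-- **Time translation on `[0, T)`.** A classical solution on `[0, T)` translated by `s ≥ 0` is
a classical solution on `[0, T - s)` (restrict `comp_add_right` from `(· + s)⁻¹' [0, T) ⊇
[0, T - s)`; `e` smooth on `ρ, ϑ > 0`; void unless `s < T`). [folklore] -/
theorem IsClassicalEulerSolution.translate_Ico {s : ℝ} (h : IsClassicalEulerSolution eos T ρ u ϑ)
    (he : ContDiffOn ℝ ∞ (uncurry eos.e) (Ioi 0 ×ˢ Ioi 0)) (hs : 0 ≤ s) :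
    IsClassicalEulerSolution eos (T - s) (fun t => ρ (t + s)) (fun t => u (t + s))
      (fun t => ϑ (t + s)) :=
  isClassicalEulerSolutionOn_Ico_iff.1 <|
    ((isClassicalEulerSolutionOn_Ico_iff.2 h).comp_add_right s).mono he
      (fun t ht => ⟨by linarith [ht.1], by linarith [ht.2]⟩) (uniqueDiffOn_Ico 0 (T - s))

/-- At interior times the one-sided time derivatives within `(a, b)` and within `[a, b)` agree
(both are the two-sided derivative; Mathlib `derivWithin_of_mem_nhds`). [folklore] -/
theorem timeDerivWithin_Ioo_eq_Ico {F : Type*} [NormedAddCommGroup F] [NormedSpace ℝ F]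
    (w : ℝ → UnitAddTorus (Fin 3) → F) {a b t : ℝ} (ht : t ∈ Ioo a b) (x : UnitAddTorus (Fin 3)) :
    FunctionSpaces.Torus.timeDerivWithin (Ioo a b) w t x =
      FunctionSpaces.Torus.timeDerivWithin (Ico a b) w t x := by
  simp only [FunctionSpaces.Torus.timeDerivWithin]
  rw [derivWithin_of_mem_nhds (Ioo_mem_nhds ht.1 ht.2),
    derivWithin_of_mem_nhds (Ico_mem_nhds ht.1 ht.2)]

/-- **Undoing a translation on the open interval.** If the translate `(ρ, u, ϑ)(· + t₀)` is a
classical solution on `[0, δ)`, then `(ρ, u, ϑ)` is a classical solution on the OPEN interval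
`(t₀, t₀ + δ)` (translate back by `-t₀` to `[t₀, t₀ + δ)` and drop the left end point; at interior
times all time derivatives are two-sided, so no hypothesis on `e` is needed). [folklore] -/
theorem IsClassicalEulerSolution.on_Ioo_of_translate {t₀ δ : ℝ}
    (h : IsClassicalEulerSolution eos δ (fun t => ρ (t + t₀)) (fun t => u (t + t₀))
      (fun t => ϑ (t + t₀))) :
    IsClassicalEulerSolutionOn eos (Ioo t₀ (t₀ + δ)) ρ u ϑ := by
  have hpre : (· + -t₀) ⁻¹' Ico 0 δ = Ico t₀ (t₀ + δ) := by
    ext t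
    simp only [mem_preimage, mem_Ico]
    constructor <;> intro ht <;> constructor <;> linarith [ht.1, ht.2]
  have h' : IsClassicalEulerSolutionOn eos (Ico t₀ (t₀ + δ)) ρ u ϑ := by
    have h'' := (isClassicalEulerSolutionOn_Ico_iff.2 h).comp_add_right (-t₀)
    simp only [neg_add_cancel_right] at h''
    rwa [hpre] at h''
  have hI : Ioo t₀ (t₀ + δ) ⊆ Ico t₀ (t₀ + δ) := Ioo_subset_Ico_self
  exact
    { smooth_density := h'.smooth_density.mono hI
      smooth_velocity := h'.smooth_velocity.mono hI
      smooth_temperature := h'.smooth_temperature.mono hI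
      density_pos := fun t ht x => h'.density_pos t (hI ht) x
      temperature_pos := fun t ht x => h'.temperature_pos t (hI ht) x
      mass := fun t ht x => by
        rw [timeDerivWithin_Ioo_eq_Ico ρ ht x]
        exact h'.mass t (hI ht) x
      momentum := fun t ht x => by
        rw [timeDerivWithin_Ioo_eq_Ico (fun s y => ρ s y • u s y) ht x]
        exact h'.momentum t (hI ht) x
      energy := fun t ht x => by
        rw [timeDerivWithin_Ioo_eq_Ico (fun s y => ρ s y * (‖u s y‖ ^ 2 / 2 + eos.e (ρ s y) (ϑ s y))) ht x]
        exact h'.energy t (hI ht) x }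

/-! ## Gluing along an open overlap -/

section Glue

variable {α : Type*}

/-- Left of the gluing time the glued function is eventually the left piece. [folklore] -/
theorem ite_eventuallyEq_left {T t : ℝ} (f₁ f₂ : ℝ → α) (htT : t < T) :
    (fun τ => if τ < T then f₁ τ else f₂ τ) =ᶠ[𝓝 t] f₁ := by
  filter_upwards [Iio_mem_nhds htT] with τ hτ
  rw [if_pos (show τ < T from hτ)]

/-- Right of `a` the glued function is eventually the right piece, if the pieces agree on
`(a, T)`. [folklore] -/
theorem ite_eventuallyEq_right {T a t : ℝ} (f₁ f₂ : ℝ → α) (hat : a < t) (hTt : T ≤ t)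
    (heq : ∀ τ ∈ Ioo a T, f₁ τ = f₂ τ) :
    (fun τ => if τ < T then f₁ τ else f₂ τ) =ᶠ[𝓝 t] f₂ := by
  have _ := hTt
  filter_upwards [Ioi_mem_nhds hat] with τ hτ
  by_cases hτT : τ < T
  · rw [if_pos hτT, heq τ ⟨hτ, hτT⟩]
  · rw [if_neg hτT]

variable {F : Type*} [NormedAddCommGroup F] [NormedSpace ℝ F]

/-- The one-sided time derivative within `[0, b)` at a time `t < T ≤ b` of a field that near `t`
coincides with `w` is the time derivative of `w` within `[0, T)` (Mathlib `derivWithin_inter`,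
`Filter.EventuallyEq.derivWithin_eq`). [folklore] -/
theorem timeDerivWithin_Ico_eq_left {T b t : ℝ} {v w : ℝ → UnitAddTorus (Fin 3) → F}
    (htT : t < T) (hTb : T ≤ b) (x : UnitAddTorus (Fin 3)) (hev : v =ᶠ[𝓝 t] w) :
    FunctionSpaces.Torus.timeDerivWithin (Ico 0 b) v t x =
      FunctionSpaces.Torus.timeDerivWithin (Ico 0 T) w t x := by
  have hI : Ico 0 b ∩ Iio T = Ico 0 T := by
    ext τ
    simp only [mem_inter_iff, mem_Ico, mem_Iio]
    exact ⟨fun h => ⟨h.1.1, h.2⟩, fun h => ⟨⟨h.1, h.2.trans_le hTb⟩, h.2⟩⟩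
  have hev' : (fun τ => v τ x) =ᶠ[𝓝 t] fun τ => w τ x := hev.mono fun τ hτ => by
    show v τ x = w τ x
    rw [hτ]
  simp only [FunctionSpaces.Torus.timeDerivWithin]
  rw [(hev'.filter_mono nhdsWithin_le_nhds).derivWithin_eq hev'.self_of_nhds, ← hI,
    derivWithin_inter (Iio_mem_nhds htT)]

/-- The one-sided time derivative within `[0, b)` at a time `t ∈ (a, b)`, `0 ≤ a`, of a field that
near `t` coincides with `w` is the time derivative of `w` within `(a, b)` (both are two-sided;
Mathlib `derivWithin_of_mem_nhds`). [folklore] -/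
theorem timeDerivWithin_Ico_eq_right {a b t : ℝ} {v w : ℝ → UnitAddTorus (Fin 3) → F}
    (ha : 0 ≤ a) (hat : a < t) (htb : t < b) (x : UnitAddTorus (Fin 3)) (hev : v =ᶠ[𝓝 t] w) :
    FunctionSpaces.Torus.timeDerivWithin (Ico 0 b) v t x =
      FunctionSpaces.Torus.timeDerivWithin (Ioo a b) w t x := by
  have hev' : (fun τ => v τ x) =ᶠ[𝓝 t] fun τ => w τ x := hev.mono fun τ hτ => by
    show v τ x = w τ x
    rw [hτ]
  simp only [FunctionSpaces.Torus.timeDerivWithin]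
  rw [(hev'.filter_mono nhdsWithin_le_nhds).derivWithin_eq hev'.self_of_nhds,
    derivWithin_of_mem_nhds (Ico_mem_nhds (ha.trans_lt hat) htb),
    derivWithin_of_mem_nhds (Ioo_mem_nhds hat htb)]

/-- **Gluing jointly smooth fields along an open overlap.** If `w₁` is jointly smooth on
`[0, T) × 𝕋³`, `w₂` on `(a, b) × 𝕋³`, `0 ≤ a < T ≤ b`, and `w₁(t) = w₂(t)` for `t ∈ (a, T)`, then
the field equal to `w₁` before `T` and to `w₂` from `T` on is jointly smooth on `[0, b) × 𝕋³`
(smoothness is local, Mathlib `contDiffOn_of_locally_contDiffOn`; the pieces `[0, T)` and `(a, b)`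
are relatively open in `[0, b)`). [folklore] -/
theorem isSmoothSpaceTimeOn_glue {T a b : ℝ} {w₁ w₂ : ℝ → UnitAddTorus (Fin 3) → F}
    (h₁ : FunctionSpaces.Torus.IsSmoothSpaceTimeOn (Ico 0 T) w₁)
    (h₂ : FunctionSpaces.Torus.IsSmoothSpaceTimeOn (Ioo a b) w₂) (ha : 0 ≤ a) (haT : a < T)
    (hTb : T ≤ b) (heq : ∀ t ∈ Ioo a T, w₁ t = w₂ t) :
    FunctionSpaces.Torus.IsSmoothSpaceTimeOn (Ico 0 b) (fun t => if t < T then w₁ t else w₂ t) := by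
  have hP₁ : (Ico 0 b ×ˢ (univ : Set (EuclideanSpace ℝ (Fin 3)))) ∩ Iio T ×ˢ univ = Ico 0 T ×ˢ univ := by
    rw [prod_inter_prod, inter_self]
    congr 1
    ext τ
    simp only [mem_inter_iff, mem_Ico, mem_Iio]
    exact ⟨fun h => ⟨h.1.1, h.2⟩, fun h => ⟨⟨h.1, h.2.trans_le hTb⟩, h.2⟩⟩
  have hP₂ : (Ico 0 b ×ˢ (univ : Set (EuclideanSpace ℝ (Fin 3)))) ∩ Ioi a ×ˢ univ = Ioo a b ×ˢ univ := by
    rw [prod_inter_prod, inter_self]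
    congr 1
    ext τ
    simp only [mem_inter_iff, mem_Ico, mem_Ioi, mem_Ioo]
    exact ⟨fun h => ⟨h.2, h.1.2⟩, fun h => ⟨⟨ha.trans h.1.le, h.2⟩, h.1⟩⟩
  refine contDiffOn_of_locally_contDiffOn fun z hz => ?_
  obtain ⟨t, y⟩ := z
  by_cases htT : t < T
  · refine ⟨Iio T ×ˢ univ, isOpen_Iio.prod isOpen_univ, ⟨htT, mem_univ _⟩, ?_⟩
    rw [hP₁]
    refine h₁.congr fun z hz => ?_
    obtain ⟨τ, y'⟩ := z
    have hτ : τ < T := hz.1.2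
    simp only [FunctionSpaces.Torus.stLift_apply, if_pos hτ]
  · refine ⟨Ioi a ×ˢ univ, isOpen_Ioi.prod isOpen_univ, ⟨haT.trans_le (not_lt.1 htT), mem_univ _⟩, ?_⟩
    rw [hP₂]
    refine h₂.congr fun z hz => ?_
    obtain ⟨τ, y'⟩ := z
    have hτ : τ ∈ Ioo a b := hz.1
    by_cases hτT : τ < T
    · simp only [FunctionSpaces.Torus.stLift_apply, if_pos hτT, heq τ ⟨hτ.1, hτT⟩]
    · simp only [FunctionSpaces.Torus.stLift_apply, if_neg hτT]

variable {ρ₁ ρ₂ : ℝ → UnitAddTorus (Fin 3) → ℝ}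
  {u₁ u₂ : ℝ → UnitAddTorus (Fin 3) → EuclideanSpace ℝ (Fin 3)} {ϑ₁ ϑ₂ : ℝ → UnitAddTorus (Fin 3) → ℝ}

/-- **Gluing classical solutions of the complete Euler system along an open overlap.** Let
`(ρ₁, u₁, ϑ₁)` be a classical solution on `[0, T)` and `(ρ₂, u₂, ϑ₂)` one on `(a, b)` (same
equation of state), `0 ≤ a < T ≤ b`, with `(ρ₁, u₁, ϑ₁)(t) = (ρ₂, u₂, ϑ₂)(t)` for `t ∈ (a, T)`.
Then the fields equal to the first solution for `t < T` and to the second for `t ≥ T` form a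
classical solution on `[0, b)`: joint smoothness by `isSmoothSpaceTimeOn_glue`; at `t < T` the
three conservation laws are those of the first solution (near `t` the glued fields, hence the
glued conserved densities, are the first ones, and `[0, b)` agrees with `[0, T)` near `t`:
`timeDerivWithin_Ico_eq_left`), at `t ≥ T` those of the second (interior time, two-sided
derivatives: `timeDerivWithin_Ico_eq_right`) (Dafermos 2005, proof of Thm 5.1.1, restart step;
Majda 1984, Thm 2.2, Cor. 2). [folklore] -/
theorem IsClassicalEulerSolutionOn.glue {T a b : ℝ}
    (h₁ : IsClassicalEulerSolutionOn eos (Ico 0 T) ρ₁ u₁ ϑ₁)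
    (h₂ : IsClassicalEulerSolutionOn eos (Ioo a b) ρ₂ u₂ ϑ₂) (ha : 0 ≤ a) (haT : a < T) (hTb : T ≤ b)
    (heq : ∀ t ∈ Ioo a T, ρ₁ t = ρ₂ t ∧ u₁ t = u₂ t ∧ ϑ₁ t = ϑ₂ t) :
    IsClassicalEulerSolutionOn eos (Ico 0 b) (fun t => if t < T then ρ₁ t else ρ₂ t)
      (fun t => if t < T then u₁ t else u₂ t) (fun t => if t < T then ϑ₁ t else ϑ₂ t) := by
  have hρ : ∀ t ∈ Ioo a T, ρ₁ t = ρ₂ t := fun t ht => (heq t ht).1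
  have hu : ∀ t ∈ Ioo a T, u₁ t = u₂ t := fun t ht => (heq t ht).2.1
  have hϑ : ∀ t ∈ Ioo a T, ϑ₁ t = ϑ₂ t := fun t ht => (heq t ht).2.2
  -- the glued conserved densities near a time `t < T`, resp. `t ≥ T`
  have hmomL : ∀ {t}, t < T → (fun s y => (if s < T then ρ₁ s else ρ₂ s) y • (if s < T then u₁ s else u₂ s) y)
      =ᶠ[𝓝 t] fun s y => ρ₁ s y • u₁ s y := fun htT => by
    filter_upwards [ite_eventuallyEq_left ρ₁ ρ₂ htT, ite_eventuallyEq_left u₁ u₂ htT] with s h1 h2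
    rw [h1, h2]
  have hmomR : ∀ {t}, a < t → T ≤ t →
      (fun s y => (if s < T then ρ₁ s else ρ₂ s) y • (if s < T then u₁ s else u₂ s) y)
      =ᶠ[𝓝 t] fun s y => ρ₂ s y • u₂ s y := fun hat hTt => by
    filter_upwards [ite_eventuallyEq_right ρ₁ ρ₂ hat hTt hρ, ite_eventuallyEq_right u₁ u₂ hat hTt hu]
      with s h1 h2
    rw [h1, h2]
  have henL : ∀ {t}, t < T →
      (fun s y => (if s < T then ρ₁ s else ρ₂ s) y *
        (‖(if s < T then u₁ s else u₂ s) y‖ ^ 2 / 2 +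
          eos.e ((if s < T then ρ₁ s else ρ₂ s) y) ((if s < T then ϑ₁ s else ϑ₂ s) y)))
      =ᶠ[𝓝 t] fun s y => ρ₁ s y * (‖u₁ s y‖ ^ 2 / 2 + eos.e (ρ₁ s y) (ϑ₁ s y)) := fun htT => by
    filter_upwards [ite_eventuallyEq_left ρ₁ ρ₂ htT, ite_eventuallyEq_left u₁ u₂ htT,
      ite_eventuallyEq_left ϑ₁ ϑ₂ htT] with s h1 h2 h3
    rw [h1, h2, h3]
  have henR : ∀ {t}, a < t → T ≤ t →
      (fun s y => (if s < T then ρ₁ s else ρ₂ s) y *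
        (‖(if s < T then u₁ s else u₂ s) y‖ ^ 2 / 2 +
          eos.e ((if s < T then ρ₁ s else ρ₂ s) y) ((if s < T then ϑ₁ s else ϑ₂ s) y)))
      =ᶠ[𝓝 t] fun s y => ρ₂ s y * (‖u₂ s y‖ ^ 2 / 2 + eos.e (ρ₂ s y) (ϑ₂ s y)) := fun hat hTt => by
    filter_upwards [ite_eventuallyEq_right ρ₁ ρ₂ hat hTt hρ, ite_eventuallyEq_right u₁ u₂ hat hTt hu,
      ite_eventuallyEq_right ϑ₁ ϑ₂ hat hTt hϑ] with s h1 h2 h3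
    rw [h1, h2, h3]
  refine ⟨isSmoothSpaceTimeOn_glue h₁.smooth_density h₂.smooth_density ha haT hTb hρ,
    isSmoothSpaceTimeOn_glue h₁.smooth_velocity h₂.smooth_velocity ha haT hTb hu,
    isSmoothSpaceTimeOn_glue h₁.smooth_temperature h₂.smooth_temperature ha haT hTb hϑ,
    fun t ht x => ?_, fun t ht x => ?_, fun t ht x => ?_, fun t ht x => ?_, fun t ht x => ?_⟩
  · by_cases htT : t < T
    · simp only [if_pos htT]; exact h₁.density_pos t ⟨ht.1, htT⟩ x
    · simp only [if_neg htT]; exact h₂.density_pos t ⟨haT.trans_le (not_lt.1 htT), ht.2⟩ x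
  · by_cases htT : t < T
    · simp only [if_pos htT]; exact h₁.temperature_pos t ⟨ht.1, htT⟩ x
    · simp only [if_neg htT]; exact h₂.temperature_pos t ⟨haT.trans_le (not_lt.1 htT), ht.2⟩ x
  · -- mass
    by_cases htT : t < T
    · rw [timeDerivWithin_Ico_eq_left htT hTb x (ite_eventuallyEq_left ρ₁ ρ₂ htT)]
      simp only [if_pos htT]
      exact h₁.mass t ⟨ht.1, htT⟩ x
    · have hTt : T ≤ t := not_lt.1 htT
      have hat : a < t := haT.trans_le hTt
      rw [timeDerivWithin_Ico_eq_right ha hat ht.2 x (ite_eventuallyEq_right ρ₁ ρ₂ hat hTt hρ)]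
      simp only [if_neg htT]
      exact h₂.mass t ⟨hat, ht.2⟩ x
  · -- momentum
    by_cases htT : t < T
    · rw [timeDerivWithin_Ico_eq_left htT hTb x (hmomL htT)]
      simp only [if_pos htT]
      exact h₁.momentum t ⟨ht.1, htT⟩ x
    · have hTt : T ≤ t := not_lt.1 htT
      have hat : a < t := haT.trans_le hTt
      rw [timeDerivWithin_Ico_eq_right ha hat ht.2 x (hmomR hat hTt)]
      simp only [if_neg htT]
      exact h₂.momentum t ⟨hat, ht.2⟩ x
  · -- energy
    by_cases htT : t < T
    · rw [timeDerivWithin_Ico_eq_left htT hTb x (henL htT)]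
      simp only [if_pos htT]
      exact h₁.energy t ⟨ht.1, htT⟩ x
    · have hTt : T ≤ t := not_lt.1 htT
      have hat : a < t := haT.trans_le hTt
      rw [timeDerivWithin_Ico_eq_right ha hat ht.2 x (henR hat hTt)]
      simp only [if_neg htT]
      exact h₂.energy t ⟨hat, ht.2⟩ x

/-- **The restart step of the continuation argument.** Let `(ρ₁, u₁, ϑ₁)` be a classical solution
on `[0, T)` and let `(ρ₂, u₂, ϑ₂)` be fields whose translate by `t₀ ∈ [0, T)` is a classical
solution on `[0, δ)` with `T ≤ t₀ + δ` — a solution restarted at time `t₀` — that agrees with the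
first solution on the open overlap `(t₀, T)`. Then there is a classical solution on
`[0, t₀ + δ)` which coincides with `(ρ₁, u₁, ϑ₁)` on `[0, T)` (glue by
`IsClassicalEulerSolutionOn.glue` after `IsClassicalEulerSolution.on_Ioo_of_translate`)
(Dafermos 2005, proof of Thm 5.1.1; Majda 1984, Thm 2.2, Cor. 2). [folklore] -/
theorem IsClassicalEulerSolution.extend_of_restart {t₀ δ : ℝ}
    (h₁ : IsClassicalEulerSolution eos T ρ₁ u₁ ϑ₁)
    (h₂ : IsClassicalEulerSolution eos δ (fun t => ρ₂ (t + t₀)) (fun t => u₂ (t + t₀))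
      (fun t => ϑ₂ (t + t₀)))
    (ht₀ : 0 ≤ t₀) (ht₀T : t₀ < T) (hT : T ≤ t₀ + δ)
    (heq : ∀ t ∈ Ioo t₀ T, ρ₁ t = ρ₂ t ∧ u₁ t = u₂ t ∧ ϑ₁ t = ϑ₂ t) :
    ∃ (ρ ϑ : ℝ → UnitAddTorus (Fin 3) → ℝ) (u : ℝ → UnitAddTorus (Fin 3) → EuclideanSpace ℝ (Fin 3)),
      IsClassicalEulerSolution eos (t₀ + δ) ρ u ϑ ∧
        ∀ t ∈ Ico 0 T, ρ t = ρ₁ t ∧ u t = u₁ t ∧ ϑ t = ϑ₁ t := by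
  refine ⟨_, _, _, isClassicalEulerSolutionOn_Ico_iff.1
    ((isClassicalEulerSolutionOn_Ico_iff.2 h₁).glue h₂.on_Ioo_of_translate ht₀ ht₀T hT heq),
    fun t ht => ?_⟩
  simp only [if_pos ht.2, and_self]

end Glue

end CompressibleEuler

end Literature.Analysis.FluidPDE

end
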